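import Literature.Analysis.Complex.JensenCircles

/-!
# Successor Certificate §0-§1: Pair Factorisation and Frozen Successor Law

W-07 · route `EarlyAppointments` · crux `TiltedLandingLaw421` (stmt-RiemannHypothesis-24774).
Support module from C3 g22/g23 (a8b429b0). Part 1 of 2: definitions and the frozen successor law.

CONTENT (all K, 0 sorry):
- §0 `PairFactor` (g = ((z − a)² + ε²)·h), `hasDerivAt_quadP`, `hasDerivAt_pairMulP`,
  `exists_zero_of_sphere_bound` (open-mapping Rouché substitute), `deriv_pair_eq_G`;
- §1 `successor_of_netField` — the FROZEN successor law, `SuccColAt`, `FrozenGAt` + `frozenGAt_exit`.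

[cite: rh-idea-3 g23 SuccessorCertificate-W07c12]
-/

open Set Complex Metric Filter Topology

noncomputable section

namespace RhW07.Law421.SuccessorCertificate

/-! ## §0 pair factorisation, the Rouché substitute, the G-identity -/

/-- the PAIR FACTORISATION of `g` at the pair `a ± iε`: `g = ((z − a)² + ε²)·h`, `h` entire and real on `ℝ`
(for a class function with a simple pair this is division by the pair; `h` = «everything else», `h′/h` = the AMBIENT FIELD). -/
def PairFactor (g h : ℂ → ℂ) (a ε : ℝ) : Prop :=
  Differentiable ℂ h ∧ (∀ x : ℝ, (h x).im = 0) ∧ ∀ z : ℂ, g z = ((z - a) ^ 2 + (ε : ℂ) ^ 2) * h z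

/-- Derivative of the quadratic factor `(w − a)² + ε²` at `z` is `2(z − a)`. -/
theorem hasDerivAt_quadP (a ε : ℝ) (z : ℂ) :
    HasDerivAt (fun w : ℂ ↦ (w - a) ^ 2 + (ε : ℂ) ^ 2) (2 * (z - a)) z := by
  have h0 : HasDerivAt (fun w : ℂ ↦ (w - a) ^ 2) (((2 : ℕ) : ℂ) * (z - a) ^ (2 - 1) * 1) z :=
    ((hasDerivAt_id' z).sub_const (a : ℂ)).pow 2
  have h1 : HasDerivAt (fun w : ℂ ↦ (w - a) ^ 2) (2 * (z - a)) z :=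
    h0.congr_deriv (by norm_num)
  exact h1.add_const _

/-- Product rule for the pair factor times an entire function `h`. -/
theorem hasDerivAt_pairMulP {h : ℂ → ℂ} (hh : Differentiable ℂ h) (a ε : ℝ) (z : ℂ) :
    HasDerivAt (fun w : ℂ ↦ ((w - a) ^ 2 + (ε : ℂ) ^ 2) * h w)
      (2 * (z - a) * h z + ((z - a) ^ 2 + (ε : ℂ) ^ 2) * deriv h z) z :=
  (hasDerivAt_quadP a ε z).mul (hh z).hasDerivAt

/-- **Rouché substitute.** `f` holomorphic on `D̄(z₀, r)`, `‖f z − f z₀‖ ≥ e` on the circle and `‖f z₀‖ < e/2` ⇒ `f` has a zero in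
`D̄(z₀, r)` (Mathlib's open-mapping covering lemma `DiffContOnCl.ball_subset_image_closedBall` applied to `0 ∈ D(f z₀, e/2)`). -/
theorem exists_zero_of_sphere_bound {f : ℂ → ℂ} {z₀ : ℂ} {r e : ℝ}
    (hf : DifferentiableOn ℂ f (closedBall z₀ r)) (hr : 0 < r)
    (he : ∀ z ∈ sphere z₀ r, e ≤ ‖f z - f z₀‖) (h0 : ‖f z₀‖ < e / 2) :
    ∃ z ∈ closedBall z₀ r, f z = 0 := by
  have hdc : DiffContOnCl ℂ f (ball z₀ r) := by
    refine ⟨hf.mono ball_subset_closedBall, ?_⟩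
    rw [closure_ball z₀ hr.ne']
    exact hf.continuousOn
  have hz₀ : ∃ᶠ z in 𝓝 z₀, f z ≠ f z₀ := by
    by_contra hcon
    rw [Filter.not_frequently] at hcon
    have hev : f =ᶠ[𝓝 z₀] fun _ ↦ f z₀ := hcon.mono fun z hz ↦ not_not.mp hz
    have han : AnalyticOnNhd ℂ f (ball z₀ r) :=
      (hf.mono ball_subset_closedBall).analyticOnNhd isOpen_ball
    have hconst : EqOn f (fun _ ↦ f z₀) (ball z₀ r) :=
      han.eqOn_of_preconnected_of_eventuallyEq analyticOnNhd_const
        (convex_ball z₀ r).isPreconnected (mem_ball_self hr) hev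
    have hconst' : EqOn f (fun _ ↦ f z₀) (closedBall z₀ r) :=
      hconst.of_subset_closure hf.continuousOn continuousOn_const ball_subset_closedBall
        (by rw [closure_ball z₀ hr.ne'])
    have hzs : z₀ + r ∈ sphere z₀ r := by
      rw [mem_sphere, dist_eq_norm, add_sub_cancel_left, Complex.norm_real, Real.norm_eq_abs, abs_of_pos hr]
    have h1 := he (z₀ + r) hzs
    have h2 : f (z₀ + r) = f z₀ := hconst' (sphere_subset_closedBall hzs)
    rw [h2, sub_self, norm_zero] at h1
    linarith [norm_nonneg (f z₀)]
  have hsub := hdc.ball_subset_image_closedBall hr he hz₀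
  have h0mem : (0 : ℂ) ∈ ball (f z₀) (e / 2) := by
    rw [mem_ball, dist_eq_norm, zero_sub, norm_neg]
    exact h0
  obtain ⟨z, hz, hfz⟩ := hsub h0mem
  exact ⟨z, hz, hfz⟩

/-- The G-identity: `g′ = (z − v̄)·h·(1 + (z − u)·b)` where `b = (z − v̄)⁻¹ + h′/h` is the net field. -/
theorem deriv_pair_eq_G {g h : ℂ → ℂ} {a ε : ℝ} (hPF : PairFactor g h a ε) {z : ℂ} (hh : h z ≠ 0)
    (hv : z ≠ (a : ℂ) - (ε : ℂ) * I) :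
    deriv g z = (z - ((a : ℂ) - (ε : ℂ) * I)) * h z *
      (1 + (z - ((a : ℂ) + (ε : ℂ) * I)) * ((z - ((a : ℂ) - (ε : ℂ) * I))⁻¹ + deriv h z / h z)) := by
  obtain ⟨hh', -, hg⟩ := hPF
  have hfun : g = fun w : ℂ ↦ ((w - a) ^ 2 + (ε : ℂ) ^ 2) * h w := funext hg
  rw [hfun, (hasDerivAt_pairMulP hh' a ε z).deriv]
  have hv' : z - ((a : ℂ) - (ε : ℂ) * I) ≠ 0 := sub_ne_zero.mpr hv
  have e2 : h z * (deriv h z / h z) = deriv h z := by field_simp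
  have e3 : (z - ((a : ℂ) - (ε : ℂ) * I)) * (z - ((a : ℂ) - (ε : ℂ) * I))⁻¹ = 1 := mul_inv_cancel₀ hv'
  have e1 : (z - ((a : ℂ) - (ε : ℂ) * I)) * h z *
        (1 + (z - ((a : ℂ) + (ε : ℂ) * I)) * ((z - ((a : ℂ) - (ε : ℂ) * I))⁻¹ + deriv h z / h z))
      = (z - ((a : ℂ) - (ε : ℂ) * I)) * h z
        + (z - ((a : ℂ) + (ε : ℂ) * I)) * h z * ((z - ((a : ℂ) - (ε : ℂ) * I)) * (z - ((a : ℂ) - (ε : ℂ) * I))⁻¹)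
        + (z - ((a : ℂ) + (ε : ℂ) * I)) * (z - ((a : ℂ) - (ε : ℂ) * I)) * (h z * (deriv h z / h z)) := by ring
  rw [e1, e2, e3]
  linear_combination (ε : ℂ) ^ 2 * deriv h z * Complex.I_sq

/-! ## §1 THE NET (FROZEN) SUCCESSOR LAW -/

/-- ★★ **THE NET SUCCESSOR LAW (K).**  `PairFactor g h a ε`, `c ≠ 0`, `0 < ρ`, `4Θ < ρ‖c‖(‖c‖ − Θ)`, and on
`D̄(a + iε − 1/c, ρ)`: `h ≠ 0`, `z ≠ a − iε`, `‖(z − (a − iε))⁻¹ + h′/h − c‖ ≤ Θ`.  Then `g′` has a zero in `D̄(a + iε − 1/c, ρ)`.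
Proof: `exists_zero_of_sphere_bound` for `G = 1 + (z − u)·b`: `G(u − 1/c) = (c − b)/c` has norm `≤ Θ/‖c‖`; on the circle
`‖G z − G z₀‖ ≥ ρ(‖c‖ − Θ) − 2Θ/‖c‖`. -/
theorem successor_of_netField {g h : ℂ → ℂ} {a ε Θ ρ : ℝ} {c : ℂ} (hPF : PairFactor g h a ε) (hc : c ≠ 0)
    (hρ : 0 < ρ) (hnum : 4 * Θ < ρ * ‖c‖ * (‖c‖ - Θ))
    (hB : ∀ z ∈ closedBall ((a : ℂ) + (ε : ℂ) * I - 1 / c) ρ,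
      h z ≠ 0 ∧ z ≠ (a : ℂ) - (ε : ℂ) * I ∧ ‖(z - ((a : ℂ) - (ε : ℂ) * I))⁻¹ + deriv h z / h z - c‖ ≤ Θ) :
    ∃ z₁ ∈ closedBall ((a : ℂ) + (ε : ℂ) * I - 1 / c) ρ, deriv g z₁ = 0 := by
  set u : ℂ := (a : ℂ) + (ε : ℂ) * I with hu
  set v : ℂ := (a : ℂ) - (ε : ℂ) * I with hv
  set z₀ : ℂ := u - 1 / c with hz₀
  have hN : 0 < ‖c‖ := norm_pos_iff.mpr hc
  have hd1 : Differentiable ℂ (deriv h) := by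
    have := Literature.Analysis.Complex.differentiable_iteratedDeriv_of_entire hPF.1 1
    rwa [iteratedDeriv_one] at this
  set G : ℂ → ℂ := fun z ↦ 1 + (z - u) * ((z - v)⁻¹ + deriv h z / h z) with hG
  have hGd : DifferentiableOn ℂ G (closedBall z₀ ρ) := by
    intro z hz
    obtain ⟨hhz, hzv, -⟩ := hB z hz
    have hbd : DifferentiableAt ℂ (fun y : ℂ ↦ (y - v)⁻¹ + deriv h y / h y) z :=
      ((differentiableAt_fun_id.sub_const v).inv (sub_ne_zero.mpr hzv)).add ((hd1 z).div (hPF.1 z) hhz)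
    exact ((differentiableAt_const (1 : ℂ)).add ((differentiableAt_fun_id.sub_const u).mul hbd)).differentiableWithinAt
  have hz0c : z₀ ∈ closedBall z₀ ρ := mem_closedBall_self hρ.le
  have hlow : ∀ z ∈ closedBall z₀ ρ, ‖c‖ - Θ ≤ ‖(z - v)⁻¹ + deriv h z / h z‖ := by
    intro z hz
    have t := (hB z hz).2.2
    have t' : ‖c - ((z - v)⁻¹ + deriv h z / h z)‖ ≤ Θ := by rw [norm_sub_rev]; exact t
    have := norm_sub_norm_le c ((z - v)⁻¹ + deriv h z / h z)
    linarith
  have he : ∀ z ∈ sphere z₀ ρ, ρ * (‖c‖ - Θ) - 2 * Θ / ‖c‖ ≤ ‖G z - G z₀‖ := by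
    intro z hz
    have hzc : z ∈ closedBall z₀ ρ := sphere_subset_closedBall hz
    have hρ' : ‖z - z₀‖ = ρ := by rw [← dist_eq_norm]; exact hz
    have e1 : G z - G z₀ = (z - z₀) * ((z - v)⁻¹ + deriv h z / h z)
        + (z₀ - u) * (((z - v)⁻¹ + deriv h z / h z) - ((z₀ - v)⁻¹ + deriv h z₀ / h z₀)) := by
      simp only [hG]; ring
    have hzu : z₀ - u = -(1 / c) := by simp only [hz₀]; ring
    have n1 : ρ * (‖c‖ - Θ) ≤ ‖(z - z₀) * ((z - v)⁻¹ + deriv h z / h z)‖ := by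
      rw [norm_mul, hρ']; exact mul_le_mul_of_nonneg_left (hlow z hzc) hρ.le
    have n2 : ‖(z₀ - u) * (((z - v)⁻¹ + deriv h z / h z) - ((z₀ - v)⁻¹ + deriv h z₀ / h z₀))‖ ≤ 2 * Θ / ‖c‖ := by
      rw [hzu, norm_mul, norm_neg, norm_div, norm_one]
      have t1 := (hB z hzc).2.2
      have t2 := (hB z₀ hz0c).2.2
      have t3 : ‖((z - v)⁻¹ + deriv h z / h z) - ((z₀ - v)⁻¹ + deriv h z₀ / h z₀)‖ ≤ 2 * Θ := by
        calc ‖((z - v)⁻¹ + deriv h z / h z) - ((z₀ - v)⁻¹ + deriv h z₀ / h z₀)‖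
            = ‖((z - v)⁻¹ + deriv h z / h z - c) - ((z₀ - v)⁻¹ + deriv h z₀ / h z₀ - c)‖ := by ring_nf
          _ ≤ ‖(z - v)⁻¹ + deriv h z / h z - c‖ + ‖(z₀ - v)⁻¹ + deriv h z₀ / h z₀ - c‖ := norm_sub_le _ _
          _ ≤ 2 * Θ := by linarith
      calc 1 / ‖c‖ * ‖((z - v)⁻¹ + deriv h z / h z) - ((z₀ - v)⁻¹ + deriv h z₀ / h z₀)‖
          ≤ 1 / ‖c‖ * (2 * Θ) := mul_le_mul_of_nonneg_left t3 (by positivity)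
        _ = 2 * Θ / ‖c‖ := by ring
    have n3 : ‖(z - z₀) * ((z - v)⁻¹ + deriv h z / h z)‖ ≤ ‖G z - G z₀‖
        + ‖(z₀ - u) * (((z - v)⁻¹ + deriv h z / h z) - ((z₀ - v)⁻¹ + deriv h z₀ / h z₀))‖ := by
      rw [e1]
      have := norm_sub_le ((z - z₀) * ((z - v)⁻¹ + deriv h z / h z)
          + (z₀ - u) * (((z - v)⁻¹ + deriv h z / h z) - ((z₀ - v)⁻¹ + deriv h z₀ / h z₀)))
        ((z₀ - u) * (((z - v)⁻¹ + deriv h z / h z) - ((z₀ - v)⁻¹ + deriv h z₀ / h z₀)))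
      simpa using this
    linarith
  have h0 : ‖G z₀‖ < (ρ * (‖c‖ - Θ) - 2 * Θ / ‖c‖) / 2 := by
    have hGz₀ : G z₀ = (c - ((z₀ - v)⁻¹ + deriv h z₀ / h z₀)) / c := by
      simp only [hG, hz₀]; field_simp; ring
    rw [hGz₀, norm_div]
    have t2 := (hB z₀ hz0c).2.2
    have t2' : ‖c - ((z₀ - v)⁻¹ + deriv h z₀ / h z₀)‖ ≤ Θ := by rw [norm_sub_rev]; exact t2
    have h1 : ‖c - ((z₀ - v)⁻¹ + deriv h z₀ / h z₀)‖ / ‖c‖ ≤ Θ / ‖c‖ := div_le_div_of_nonneg_right t2' hN.le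
    have key : ρ * (‖c‖ - Θ) - 2 * Θ / ‖c‖ - 2 * (Θ / ‖c‖) = (ρ * ‖c‖ * (‖c‖ - Θ) - 4 * Θ) / ‖c‖ := by
      field_simp; ring
    have pos : 0 < (ρ * ‖c‖ * (‖c‖ - Θ) - 4 * Θ) / ‖c‖ := div_pos (by linarith) hN
    linarith
  obtain ⟨z₁, hz₁, hGz₁⟩ := exists_zero_of_sphere_bound hGd hρ he h0
  refine ⟨z₁, hz₁, ?_⟩
  obtain ⟨hh1, hv1, -⟩ := hB z₁ hz₁
  have key := deriv_pair_eq_G hPF hh1 hv1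
  rw [key, ← hv, ← hu]
  have hG1 : 1 + (z₁ - u) * ((z₁ - v)⁻¹ + deriv h z₁ / h z₁) = 0 := hGz₁
  rw [hG1, mul_zero]

/-- **SUCCESSOR-IN-COLUMN** (the slot the CONFINED descent consumes): a zero of `g′` above the axis, horizontally within `σ` of `u`,
at height `≤ Im u − d`. -/
def SuccColAt (d σ : ℝ) (g : ℂ → ℂ) (u : ℂ) : Prop :=
  ∃ z₁ : ℂ, deriv g z₁ = 0 ∧ 0 < z₁.im ∧ |z₁.re - u.re| ≤ σ ∧ z₁.im ≤ u.im - d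

/-- **FROZEN-G (NET, tolerance-free) predicate** for the seam slot: the total field `b = (z − ū)⁻¹ + h′/h` is within `Θ` of `c` on
`D̄(u − 1/c, ρ)` with `4Θ < ρ‖c‖(‖c‖ − Θ)`; the successor then lies in that disc, so floor and drift are read off `−1/c` with error `ρ`. -/
def FrozenGAt (d σ : ℝ) (g : ℂ → ℂ) (u : ℂ) : Prop :=
  ∃ (h : ℂ → ℂ) (c : ℂ) (Θ ρ : ℝ), PairFactor g h u.re u.im ∧ c ≠ 0 ∧ 0 < ρ ∧ 4 * Θ < ρ * ‖c‖ * (‖c‖ - Θ) ∧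
    0 < u.im + (-1 / c).im - ρ ∧ (-1 / c).im + ρ ≤ -d ∧ |(1 / c).re| + ρ ≤ σ ∧
    ∀ z ∈ Metric.closedBall (u - 1 / c) ρ, h z ≠ 0 ∧ z ≠ ((u.re : ℝ) : ℂ) - ((u.im : ℝ) : ℂ) * I ∧
      ‖(z - (((u.re : ℝ) : ℂ) - ((u.im : ℝ) : ℂ) * I))⁻¹ + deriv h z / h z - c‖ ≤ Θ

/-- ★★ (K) **EXIT of `FrozenGAt`**: `FrozenGAt d σ g u → SuccColAt d σ g u` — tolerance-free. -/
theorem frozenGAt_exit {d σ : ℝ} {g : ℂ → ℂ} {u : ℂ} (hF : FrozenGAt d σ g u) : SuccColAt d σ g u := by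
  obtain ⟨h, c, Θ, ρ, hPF, hc, hρ, hnum, hpos, hfl, hdr, hball⟩ := hF
  have hu' : ((u.re : ℝ) : ℂ) + ((u.im : ℝ) : ℂ) * I = u := Complex.re_add_im u
  have hB : ∀ z ∈ closedBall (((u.re : ℝ) : ℂ) + ((u.im : ℝ) : ℂ) * I - 1 / c) ρ,
      h z ≠ 0 ∧ z ≠ ((u.re : ℝ) : ℂ) - ((u.im : ℝ) : ℂ) * I ∧
        ‖(z - (((u.re : ℝ) : ℂ) - ((u.im : ℝ) : ℂ) * I))⁻¹ + deriv h z / h z - c‖ ≤ Θ := by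
    rw [hu']; exact hball
  obtain ⟨z₁, hz₁, hd⟩ := successor_of_netField hPF hc hρ hnum hB
  rw [hu', Metric.mem_closedBall, dist_eq_norm] at hz₁
  have hre : |(z₁ - (u - 1 / c)).re| ≤ ‖z₁ - (u - 1 / c)‖ := Complex.abs_re_le_norm _
  have him : |(z₁ - (u - 1 / c)).im| ≤ ‖z₁ - (u - 1 / c)‖ := Complex.abs_im_le_norm _
  rw [Complex.sub_re, Complex.sub_re] at hre
  rw [Complex.sub_im, Complex.sub_im] at him
  have him1 := (abs_le.mp him).1
  have him2 := (abs_le.mp him).2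
  have hre' := abs_le.mp hre
  have hneg : (-1 / c).im = -((1 / c).im) := by rw [neg_div, Complex.neg_im]
  rw [hneg] at hpos hfl
  refine ⟨z₁, hd, by linarith, ?_, by linarith⟩
  have h2 := abs_sub_le z₁.re (u.re - (1 / c).re) u.re
  have h3 : |u.re - (1 / c).re - u.re| = |(1 / c).re| := by
    rw [show u.re - (1 / c).re - u.re = -((1 / c).re) by ring, abs_neg]
  have h4 : |z₁.re - (u.re - (1 / c).re)| ≤ ρ := abs_le.mpr ⟨by linarith, by linarith⟩
  linarith

end RhW07.Law421.SuccessorCertificate
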